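import Summits.QuantumFields.BalabanUV.Beta.FP.MixLoopPowerCountingMass

/-!
# `BalabanUV.Beta.FP.CoarseContractionProfile` — road «FP» (binder row D1), organisation γ, (pp)∕(rem) currency of R-FP-27, row **H3-BOOK (fine→pp)**:
# **THE TWO-PROFILE COARSE CONTRACTION** — a fine kernel with an exponentially weighted ROW-MASS letter, contracted against TWO weight functions with
# exponential sup-profiles centred at `n•v₀` and `n•v`, is bounded by `C₁·C₂·M·(1 + 480·e^{δ∕4}·(4∕δ)⁴)·n⁴·e^{−(δ∕2)‖v−v₀‖∞}` — the pointwise paired letter (pp)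
# of `FP/HorizontalBookkeepingPaired.rem_of_pp`, for the PLAIN piece (second weight = the transport column) and for the BY-PARTS piece (second weight = the
# column's unit difference) ([folklore] triangle-inequality bookkeeping on `ℤ⁴`, abstract kernels, every letter displayed)

HONEST DEPENDENCY (page 1, mandatory): continuum YM on T⁴ ⇐ BetaPertH ∧ nine spine estimates (0/9 proved); BetaPertH ⇐ (D1) ∧ (D4) ∧
CAP+tail; G-an2-4 gates asym, D1 and NE2/3/4.  HONEST FRAMING (cell contract, verbatim): «discharging `BetaPertH` makes Bałaban's UV
stability UNCONDITIONAL — a real constructive-QFT result; it is NOT the continuum limit and NOT the Clay problem.»  THIS MODULE is elementary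
[folklore] real analysis on `ℤ⁴` over the tree's engine `FP/MixLoopPowerCounting.sum_exp_le` (the exact power `n⁴`) and the owner's three-point split
`FP/MixLoopPowerCountingMass.coarse_sep_le` BY NAME; it asserts nothing about Bałaban's objects, cites nothing, mints no `Prop` fact, has no `def`, 0 sorry.
It DISCHARGES NOTHING of the wall: NOT (pp) for any piece of the literal's remainder (those are the counting rows' instances), NOT (rem), NOT hbook, NOT D1,
NOT BetaPertH, NOT continuum, NOT Clay.

ABSOLUTE RULE (cell charter, verbatim): «No internally-minted statement may enter as a cited fact. Every hypothesis is either kernel-proved in this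
package or a verbatim quotation of a PUBLISHED theorem with page reference. The manuscript(s) under audit are NOT citable for their own disputed
steps — they are the thing under adjudication; programme-internal (2001/route/tribunal) claims are never citable.»

WHY (R-FP-27, γ-END of record `FP/HorizontalRemainderTotal` ✓, (pp→rem) `FP/HorizontalBookkeepingPaired` ✓).  Every near-fine remainder row delivers its piece
of `T − Xtr = Jᵀ·r·J` in the pointwise paired shape (pp) `∀ v, |D v| ≤ B·e^{−δ′‖v‖∞}`, `D v = Σ_{b,b′} J₀(b)·k(b,b′)·J_v(b′)` (reference column at the coarse
origin, running column at `v`).  THIS FILE is the contraction step from FINE letters to (pp), and records the located currency point behind its shape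
(journal L-gan24leaf01-g51-1, toy kit j115548): for the window pieces pairing ONE smooth scale-`n` leg (`R = P − Γ`, `E = Gh − G₀`, `1 − Π`) with ONE
long-range leg (`|∇^jF| ≤ A(‖z‖+1)^{−2−j}`), the term with BOTH vertex differences on the long leg has ℓ¹ window mass `A·B·n⁻²·(c·ln n + O(1))` although
every pointwise letter holds (witness `F = (|z|₂²+1)⁻¹`: `Σ_{0<‖z‖∞≤n}|∇₁⁺∇₁⁻F|` = 51.7 ∕ 73.0 ∕ 95.1 ∕ 102.2 at `n` = 8 ∕ 16 ∕ 32 ∕ 40, the SIGNED mass −8.73 … −8.86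
and the `‖z‖²`-moment `n⁻²Σ‖z‖²|·|` = 16.4 … 16.6 being n-free), so NO majorant-based contraction delivers (pp) n-free for such a piece; its coarse entry is n-free
only through the smoothness of the column: ONE summation by parts in the running insertion moves one difference onto `J_v` (unit-difference profile one power
of `n` smaller — on the road `FP/PerfectColumnSharp.abs_colOf_KPerf_sub_le_sharp` ✓).  Hence the two uses of ONE lemma with TWO independent weight profiles:
(plain) `J₂ := J_v`; (by parts) `J₂ := J_v(· − w) − J_v`.  Road orientation ONLY (instance bookkeeping is RHOA-6e's ∕ GAMMA-8's): `C₁ ≍ C₂ ≍ c∕n`, `C_Δ ≍ c′∕n²`,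
so `B` is n-free iff the plain row mass is `≍ n⁻²` and the by-parts row mass `≍ n⁻¹`.

THE LETTERS (finite windows `S` (reference insertions), `S′` (running insertions); `n ≥ 1` the blocking; `δ > 0`):
* (P1) `|J₁ b| ≤ C₁·e^{−(δ∕n)‖b − n•v₀‖∞}`;  (P2) `|J₂ b′| ≤ C₂·e^{−(δ∕n)‖b′ − n•v‖∞}`  — sup profiles ONLY (no coarse-moment letter (J′) is needed on the (pp) route);
* (K) the EXPONENTIALLY WEIGHTED ROW MASS `∀ b ∈ S, Σ_{b′∈S′} e^{(δ∕(2n))‖b′−b‖∞}·|k b b′| ≤ M` (for a window piece `‖b′−b‖∞ ≤ R·n` it is `≤ e^{Rδ∕2}·Σ_{b′}|k b b′|`,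
  `expRowMass_le_of_window`).
CONTENT.
* §1 `exp_profile_split` (the two profiles against the coarse separation: `e^{−(δ∕n)‖b−n•v₀‖}·e^{−(δ∕n)‖b′−n•v‖} ≤ e^{−(δ∕2)‖v−v₀‖}·e^{−(δ∕(2n))‖b−n•v₀‖}·e^{(δ∕(2n))‖b′−b‖}`),
  `sum_exp_recentre_le` (`Σ_{b∈S} e^{−(δ∕(2n))‖b − c‖} ≤ (1 + 480·e^{δ∕4}·(4∕δ)⁴)·n⁴` for ANY centre `c`), `expRowMass_le_of_window`.
* §2 `const_nonneg_of_profile`, **`abs_biContract_le`** (`|Σ_{b∈S}Σ_{b′∈S′} J₁ b·k b b′·J₂ b′| ≤ C₁·C₂·M·(Σ_{b∈S}e^{−(δ∕(2n))‖b−n•v₀‖})·e^{−(δ∕2)‖v−v₀‖}`) and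
  **`abs_biContract_le'`** (the window sum replaced by `(1 + 480·e^{δ∕4}·(4∕δ)⁴)·n⁴`, under `0 ≤ M`).
* §3 the (pp) BINDER SHAPE of `HorizontalBookkeepingPaired.rem_of_pp` (`v₀ = 0`): **`pp_of_rowMass`** (plain piece), **`pp_of_pair`** (plain + by-parts piece,
  `B = C₁·(C₂·M₀ + C_Δ·M̃)·(1 + 480·e^{δ∕4}·(4∕δ)⁴)·n⁴`), `pp_of_rowMass_uniform` (m-indexed families with the window factor pre-absorbed: the `hpp` of
  `rem_of_pp_uniform`), `road_units_bookkeeping` (the one-line check that the road's instance sizes make `B` n-free — orientation, not an estimate).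
* §4 `tsum_fwdDiff_mul_eq_tsum_mul_bwdDiff` — the Abel re-indexing on `ℤ⁴` that turns a supplier's forward difference `k̃(b, b′+w) − k̃(b, b′)` in the running
  insertion into the pairing of `k̃` with the column's backward difference `J_v(b′−w) − J_v(b′)`.
Unit `b2b-balaban-gan24-formalise-leaf-01` (gen 51; G-an2-4 swarm leaf seat, cross-lane), 2026-08-21; `LEAVES-FP.md` row H3-BOOK (fine→pp); journal INTENT l.25673.
«not in print; our bookkeeping».
-/

noncomputable section

namespace Summit.QuantumFields.BalabanUV.Beta.FP.CoarseContractionProfile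

open Finset Real
open scoped BigOperators
open Literature.MathematicalPhysics.QuantumFieldTheory.Balaban1983to89.Beta.DyadicShell (Pt supNorm)
open Summit.QuantumFields.BalabanUV.Beta.FP.MixLoopPowerCounting (supNorm_cast_nonneg sum_exp_le)
open Summit.QuantumFields.BalabanUV.Beta.FP.MixLoopPowerCountingMass (coarse_sep_le)

variable {δ : ℝ} {n : ℕ}

/-! ## §1 Exponential bookkeeping -/

/-- [folklore] **THE TWO PROFILES AGAINST THE COARSE SEPARATION**: for `δ > 0`, `n ≥ 1` and any `b, b′, v, v₀ ∈ ℤ⁴`,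
`e^{−(δ∕n)‖b−n•v₀‖∞}·e^{−(δ∕n)‖b′−n•v‖∞} ≤ e^{−(δ∕2)‖v−v₀‖∞}·e^{−(δ∕(2n))‖b−n•v₀‖∞}·e^{(δ∕(2n))‖b′−b‖∞}` — half of each profile pays the coarse
separation (`MixLoopPowerCountingMass.coarse_sep_le`), the other half of the reference profile is kept for the window sum, and the fine separation
`‖b′−b‖` enters with the POSITIVE rate `δ∕(2n)` (to be absorbed by the kernel's row-mass letter). -/
theorem exp_profile_split (hδ : 0 < δ) (hn : 1 ≤ n) (v v₀ b b' : Pt) :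
    Real.exp (-(δ / n) * (supNorm (b - (n : ℤ) • v₀) : ℝ)) * Real.exp (-(δ / n) * (supNorm (b' - (n : ℤ) • v) : ℝ))
      ≤ Real.exp (-(δ / 2) * (supNorm (v - v₀) : ℝ)) * Real.exp (-(δ / (2 * n)) * (supNorm (b - (n : ℤ) • v₀) : ℝ))
          * Real.exp ((δ / (2 * n)) * (supNorm (b' - b) : ℝ)) := by
  rw [← Real.exp_add, ← Real.exp_add, ← Real.exp_add]
  apply Real.exp_le_exp.mpr
  have hn' : (0 : ℝ) < n := by exact_mod_cast hn
  have hsep := coarse_sep_le n v v₀ b b'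
  set A := (supNorm (b - (n : ℤ) • v₀) : ℝ) with hA
  set B := (supNorm (b' - b) : ℝ) with hB
  set C := (supNorm (b' - (n : ℤ) • v) : ℝ) with hC
  set D := (supNorm (v - v₀) : ℝ) with hD
  have hC0 : 0 ≤ C := supNorm_cast_nonneg _
  have ht : 0 < δ / (2 * n) := by positivity
  have e1 : δ / n = 2 * (δ / (2 * n)) := by field_simp
  have key : (δ / 2) * D ≤ (δ / (2 * n)) * (A + B + C) := by
    have h1 : (δ / (2 * n)) * ((n : ℝ) * D) ≤ (δ / (2 * n)) * (A + B + C) := mul_le_mul_of_nonneg_left hsep ht.le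
    have e2 : (δ / (2 * n)) * ((n : ℝ) * D) = (δ / 2) * D := by field_simp
    linarith
  rw [e1]
  nlinarith [mul_nonneg ht.le hC0]

/-- [folklore] **THE REFERENCE WINDOW SUM, ANY CENTRE, EXACT POWER n⁴**: `Σ_{b∈S} e^{−(δ∕(2n))‖b − c‖∞} ≤ (1 + 480·e^{δ∕4}·(4∕δ)⁴)·n⁴` for every finite
`S ⊂ ℤ⁴` and every centre `c` (`MixLoopPowerCounting.sum_exp_le` at rate `δ∕2`, re-centred by the translation `b ↦ b − c`). -/
theorem sum_exp_recentre_le (hδ : 0 < δ) (hn : 1 ≤ n) (S : Finset Pt) (c : Pt) :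
    ∑ b ∈ S, Real.exp (-(δ / (2 * n)) * (supNorm (b - c) : ℝ)) ≤ (1 + 480 * Real.exp (δ / 4) * (4 / δ) ^ 4) * (n : ℝ) ^ 4 := by
  have hδ2 : 0 < δ / 2 := by positivity
  have h := sum_exp_le hδ2 hn (S.image fun b => b - c)
  rw [Finset.sum_image (fun x _ y _ hxy => sub_left_injective hxy)] at h
  have e1 : δ / 2 / 2 = δ / 4 := by ring
  have e2 : 2 / (δ / 2) = 4 / δ := by
    rw [div_div_eq_mul_div]; ring
  have e3 : δ / 2 / (n : ℝ) = δ / (2 * n) := by rw [div_div]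
  rw [e1, e2, e3] at h
  exact h

/-- [folklore] **THE ROW-MASS LETTER OF A WINDOW PIECE**: if the running insertions seen from `b` lie in the window `‖b′ − b‖∞ ≤ R·n`, the exponential
weight costs the constant `e^{Rδ∕2}`: `Σ_{b′∈S′} e^{(δ∕(2n))‖b′−b‖∞}·f b′ ≤ e^{Rδ∕2}·Σ_{b′∈S′} f b′` for any `f ≥ 0` (`δ ≥ 0`, `n ≥ 1`). -/
theorem expRowMass_le_of_window (hδ : 0 ≤ δ) (hn : 1 ≤ n) {R : ℕ} {S' : Finset Pt} {b : Pt} {f : Pt → ℝ}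
    (hf : ∀ b', 0 ≤ f b') (hW : ∀ b' ∈ S', supNorm (b' - b) ≤ R * n) :
    ∑ b' ∈ S', Real.exp ((δ / (2 * n)) * (supNorm (b' - b) : ℝ)) * f b' ≤ Real.exp (R * δ / 2) * ∑ b' ∈ S', f b' := by
  have hn' : (0 : ℝ) < n := by exact_mod_cast hn
  rw [Finset.mul_sum]
  refine Finset.sum_le_sum fun b' hb' => mul_le_mul_of_nonneg_right (Real.exp_le_exp.mpr ?_) (hf b')
  have hw : (supNorm (b' - b) : ℝ) ≤ R * n := by exact_mod_cast hW b' hb'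
  have ht : 0 ≤ δ / (2 * n) := by positivity
  calc δ / (2 * n) * (supNorm (b' - b) : ℝ) ≤ δ / (2 * n) * (R * n) := mul_le_mul_of_nonneg_left hw ht
    _ = R * δ / 2 := by field_simp

/-! ## §2 The two-profile contraction -/

section Contract

variable {J₁ J₂ : Pt → ℝ} {k : Pt → Pt → ℝ} {C₁ C₂ M : ℝ}

/-- A sup profile forces a non-negative constant: from (P1) at the centre, `0 ≤ C₁`. [folklore] -/
theorem const_nonneg_of_profile {J : Pt → ℝ} {C : ℝ} {c : Pt}
    (hJ : ∀ b, |J b| ≤ C * Real.exp (-(δ / n) * (supNorm (b - c) : ℝ))) : 0 ≤ C := by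
  have h := hJ c
  have e : Real.exp (-(δ / n) * (supNorm (c - c) : ℝ)) = 1 := by simp
  rw [e, mul_one] at h
  exact (abs_nonneg _).trans h

/-- **THE TWO-PROFILE COARSE CONTRACTION** (row H3-BOOK (fine→pp)).  For finite windows `S, S′ ⊂ ℤ⁴`, two weight functions with the sup profiles
(P1) `|J₁ b| ≤ C₁e^{−(δ∕n)‖b−n•v₀‖∞}`, (P2) `|J₂ b′| ≤ C₂e^{−(δ∕n)‖b′−n•v‖∞}` and a fine kernel with the exponentially weighted ROW-MASS letter
(K) `∀ b ∈ S, Σ_{b′∈S′} e^{(δ∕(2n))‖b′−b‖∞}·|k b b′| ≤ M`: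
`|Σ_{b∈S} Σ_{b′∈S′} J₁ b·k b b′·J₂ b′| ≤ C₁·C₂·M·(Σ_{b∈S} e^{−(δ∕(2n))‖b−n•v₀‖∞})·e^{−(δ∕2)‖v−v₀‖∞}`.
All powers of `n` of an instance sit in `C₁, C₂, M` and the displayed window sum (`≤ (1 + 480e^{δ∕4}(4∕δ)⁴)·n⁴`, `sum_exp_recentre_le`). [folklore] -/
theorem abs_biContract_le (hδ : 0 < δ) (hn : 1 ≤ n) (S S' : Finset Pt) (v₀ v : Pt)
    (hJ₁ : ∀ b, |J₁ b| ≤ C₁ * Real.exp (-(δ / n) * (supNorm (b - (n : ℤ) • v₀) : ℝ)))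
    (hJ₂ : ∀ b', |J₂ b'| ≤ C₂ * Real.exp (-(δ / n) * (supNorm (b' - (n : ℤ) • v) : ℝ)))
    (hk : ∀ b ∈ S, ∑ b' ∈ S', Real.exp ((δ / (2 * n)) * (supNorm (b' - b) : ℝ)) * |k b b'| ≤ M) :
    |∑ b ∈ S, ∑ b' ∈ S', J₁ b * k b b' * J₂ b'|
      ≤ C₁ * C₂ * M * (∑ b ∈ S, Real.exp (-(δ / (2 * n)) * (supNorm (b - (n : ℤ) • v₀) : ℝ)))
          * Real.exp (-(δ / 2) * (supNorm (v - v₀) : ℝ)) := by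
  have hC₁ : 0 ≤ C₁ := const_nonneg_of_profile hJ₁
  have hC₂ : 0 ≤ C₂ := const_nonneg_of_profile hJ₂
  set ED : ℝ := Real.exp (-(δ / 2) * (supNorm (v - v₀) : ℝ)) with hED
  set eA : Pt → ℝ := fun b => Real.exp (-(δ / (2 * n)) * (supNorm (b - (n : ℤ) • v₀) : ℝ)) with heA
  set eB : Pt → Pt → ℝ := fun b b' => Real.exp ((δ / (2 * n)) * (supNorm (b' - b) : ℝ)) with heB
  -- pointwise bound per pair of insertions
  have hterm : ∀ b b', |J₁ b * k b b' * J₂ b'| ≤ (C₁ * C₂ * ED) * (eA b * (eB b b' * |k b b'|)) := by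
    intro b b'
    rw [abs_mul, abs_mul]
    have h1 : |J₁ b| * |k b b'| * |J₂ b'|
        ≤ (C₁ * Real.exp (-(δ / n) * (supNorm (b - (n : ℤ) • v₀) : ℝ))) * |k b b'|
            * (C₂ * Real.exp (-(δ / n) * (supNorm (b' - (n : ℤ) • v) : ℝ))) :=
      mul_le_mul (mul_le_mul_of_nonneg_right (hJ₁ b) (abs_nonneg _)) (hJ₂ b') (abs_nonneg _)
        (mul_nonneg (mul_nonneg hC₁ (Real.exp_pos _).le) (abs_nonneg _))
    have h2 := exp_profile_split hδ hn v v₀ b b'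
    calc |J₁ b| * |k b b'| * |J₂ b'|
        ≤ (C₁ * Real.exp (-(δ / n) * (supNorm (b - (n : ℤ) • v₀) : ℝ))) * |k b b'|
            * (C₂ * Real.exp (-(δ / n) * (supNorm (b' - (n : ℤ) • v) : ℝ))) := h1
      _ = (C₁ * C₂ * |k b b'|) * (Real.exp (-(δ / n) * (supNorm (b - (n : ℤ) • v₀) : ℝ))
            * Real.exp (-(δ / n) * (supNorm (b' - (n : ℤ) • v) : ℝ))) := by ring
      _ ≤ (C₁ * C₂ * |k b b'|) * (ED * eA b * eB b b') :=
          mul_le_mul_of_nonneg_left h2 (mul_nonneg (mul_nonneg hC₁ hC₂) (abs_nonneg _))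
      _ = (C₁ * C₂ * ED) * (eA b * (eB b b' * |k b b'|)) := by ring
  have hpre : 0 ≤ C₁ * C₂ * ED := mul_nonneg (mul_nonneg hC₁ hC₂) (Real.exp_pos _).le
  calc |∑ b ∈ S, ∑ b' ∈ S', J₁ b * k b b' * J₂ b'|
      ≤ ∑ b ∈ S, ∑ b' ∈ S', (C₁ * C₂ * ED) * (eA b * (eB b b' * |k b b'|)) :=
        (Finset.abs_sum_le_sum_abs _ _).trans (Finset.sum_le_sum fun b _ =>
          (Finset.abs_sum_le_sum_abs _ _).trans (Finset.sum_le_sum fun b' _ => hterm b b'))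
    _ = (C₁ * C₂ * ED) * ∑ b ∈ S, eA b * ∑ b' ∈ S', eB b b' * |k b b'| := by
        rw [Finset.mul_sum]
        refine Finset.sum_congr rfl fun b _ => ?_
        rw [Finset.mul_sum, Finset.mul_sum]
    _ ≤ (C₁ * C₂ * ED) * ∑ b ∈ S, eA b * M := by
        refine mul_le_mul_of_nonneg_left (Finset.sum_le_sum fun b hb => ?_) hpre
        exact mul_le_mul_of_nonneg_left (hk b hb) (Real.exp_pos _).le
    _ = C₁ * C₂ * M * (∑ b ∈ S, eA b) * ED := by
        rw [← Finset.sum_mul]; ring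

/-- **THE TWO-PROFILE COARSE CONTRACTION, CLOSED FORM**: as `abs_biContract_le` with the reference window sum bounded by
`(1 + 480·e^{δ∕4}·(4∕δ)⁴)·n⁴` (`sum_exp_recentre_le`); needs `0 ≤ M` (automatic when `S` is non-empty). [folklore] -/
theorem abs_biContract_le' (hδ : 0 < δ) (hn : 1 ≤ n) (S S' : Finset Pt) (v₀ v : Pt) (hM : 0 ≤ M)
    (hJ₁ : ∀ b, |J₁ b| ≤ C₁ * Real.exp (-(δ / n) * (supNorm (b - (n : ℤ) • v₀) : ℝ)))
    (hJ₂ : ∀ b', |J₂ b'| ≤ C₂ * Real.exp (-(δ / n) * (supNorm (b' - (n : ℤ) • v) : ℝ)))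
    (hk : ∀ b ∈ S, ∑ b' ∈ S', Real.exp ((δ / (2 * n)) * (supNorm (b' - b) : ℝ)) * |k b b'| ≤ M) :
    |∑ b ∈ S, ∑ b' ∈ S', J₁ b * k b b' * J₂ b'|
      ≤ C₁ * C₂ * M * ((1 + 480 * Real.exp (δ / 4) * (4 / δ) ^ 4) * (n : ℝ) ^ 4)
          * Real.exp (-(δ / 2) * (supNorm (v - v₀) : ℝ)) := by
  have hC₁ : 0 ≤ C₁ := const_nonneg_of_profile hJ₁
  have hC₂ : 0 ≤ C₂ := const_nonneg_of_profile hJ₂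
  refine (abs_biContract_le hδ hn S S' v₀ v hJ₁ hJ₂ hk).trans ?_
  refine mul_le_mul_of_nonneg_right ?_ (Real.exp_pos _).le
  exact mul_le_mul_of_nonneg_left (sum_exp_recentre_le hδ hn S _) (mul_nonneg (mul_nonneg hC₁ hC₂) hM)

end Contract

/-! ## §3 The (pp) binder shape (`HorizontalBookkeepingPaired.rem_of_pp`, reference insertion at the coarse origin) -/

section PP

variable {J₀ : Pt → ℝ} {J : Pt → Pt → ℝ} {k k₀ kt : Pt → Pt → ℝ} {C₁ C₂ CΔ M M₀ Mt : ℝ}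

/-- **(pp) FOR A PLAIN PIECE**: `D v := Σ_{b∈S}Σ_{b′∈S′} J₀ b·k b b′·J v b′` with the reference column (P0) `|J₀ b| ≤ C₁e^{−(δ∕n)‖b‖∞}`, the running
columns (P) `|J v b′| ≤ C₂e^{−(δ∕n)‖b′−n•v‖∞}` and the row-mass letter (K) satisfies, for EVERY `v ∈ ℤ⁴`,
`|D v| ≤ (C₁·C₂·M·(1 + 480e^{δ∕4}(4∕δ)⁴)·n⁴)·e^{−(δ∕2)‖v‖∞}` — literally the `hpp` binder of `HorizontalBookkeepingPaired.sum_sq_mul_abs_le_of_pointwise_exp`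
with `B = C₁C₂M(1 + 480e^{δ∕4}(4∕δ)⁴)n⁴` and rate `δ∕2`. [folklore] -/
theorem pp_of_rowMass (hδ : 0 < δ) (hn : 1 ≤ n) (S S' : Finset Pt) (hM : 0 ≤ M)
    (hJ₀ : ∀ b, |J₀ b| ≤ C₁ * Real.exp (-(δ / n) * (supNorm b : ℝ)))
    (hJ : ∀ v b', |J v b'| ≤ C₂ * Real.exp (-(δ / n) * (supNorm (b' - (n : ℤ) • v) : ℝ)))
    (hk : ∀ b ∈ S, ∑ b' ∈ S', Real.exp ((δ / (2 * n)) * (supNorm (b' - b) : ℝ)) * |k b b'| ≤ M) (v : Pt) :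
    |∑ b ∈ S, ∑ b' ∈ S', J₀ b * k b b' * J v b'|
      ≤ (C₁ * C₂ * M * ((1 + 480 * Real.exp (δ / 4) * (4 / δ) ^ 4) * (n : ℝ) ^ 4))
          * Real.exp (-(δ / 2) * (supNorm v : ℝ)) := by
  have hJ₁ : ∀ b, |J₀ b| ≤ C₁ * Real.exp (-(δ / n) * (supNorm (b - (n : ℤ) • (0 : Pt)) : ℝ)) := by
    intro b; simpa using hJ₀ b
  have h := abs_biContract_le' (J₂ := J v) (k := k) hδ hn S S' 0 v hM hJ₁ (hJ v) hk
  simpa using h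

/-- **(pp) FOR A PLAIN + BY-PARTS PIECE** (the supplier currency `k = k₀ + ∇ᵀk̃` of the located note):
`D v := Σ_{b∈S}Σ_{b′∈S′} J₀ b·(k₀ b b′·J v b′ + k̃ b b′·(J v (b′ − w) − J v b′))` with (P0), (P), the UNIT-DIFFERENCE profile
(PΔ) `|J v (b′ − w) − J v b′| ≤ C_Δ·e^{−(δ∕n)‖b′−n•v‖∞}` and the two row-mass letters (K₀) for `k₀` (bound `M₀`), (K̃) for `k̃` (bound `M̃`) gives, for EVERY `v`,
`|D v| ≤ (C₁·(C₂·M₀ + C_Δ·M̃)·(1 + 480e^{δ∕4}(4∕δ)⁴)·n⁴)·e^{−(δ∕2)‖v‖∞}`.  Road orientation: `C₂ ≍ c∕n`, `C_Δ ≍ c′∕n²`, `M₀ ≍ n⁻²`, `M̃ ≍ n⁻¹` ⟹ n-free. [folklore] -/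
theorem pp_of_pair (hδ : 0 < δ) (hn : 1 ≤ n) (S S' : Finset Pt) (w : Pt) (hM₀ : 0 ≤ M₀) (hMt : 0 ≤ Mt)
    (hJ₀ : ∀ b, |J₀ b| ≤ C₁ * Real.exp (-(δ / n) * (supNorm b : ℝ)))
    (hJ : ∀ v b', |J v b'| ≤ C₂ * Real.exp (-(δ / n) * (supNorm (b' - (n : ℤ) • v) : ℝ)))
    (hJΔ : ∀ v b', |J v (b' - w) - J v b'| ≤ CΔ * Real.exp (-(δ / n) * (supNorm (b' - (n : ℤ) • v) : ℝ)))
    (hk₀ : ∀ b ∈ S, ∑ b' ∈ S', Real.exp ((δ / (2 * n)) * (supNorm (b' - b) : ℝ)) * |k₀ b b'| ≤ M₀)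
    (hkt : ∀ b ∈ S, ∑ b' ∈ S', Real.exp ((δ / (2 * n)) * (supNorm (b' - b) : ℝ)) * |kt b b'| ≤ Mt) (v : Pt) :
    |∑ b ∈ S, ∑ b' ∈ S', J₀ b * (k₀ b b' * J v b' + kt b b' * (J v (b' - w) - J v b'))|
      ≤ (C₁ * (C₂ * M₀ + CΔ * Mt) * ((1 + 480 * Real.exp (δ / 4) * (4 / δ) ^ 4) * (n : ℝ) ^ 4))
          * Real.exp (-(δ / 2) * (supNorm v : ℝ)) := by
  have h0 := pp_of_rowMass (J := J) (k := k₀) hδ hn S S' hM₀ hJ₀ hJ hk₀ v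
  have hJ₁ : ∀ b, |J₀ b| ≤ C₁ * Real.exp (-(δ / n) * (supNorm (b - (n : ℤ) • (0 : Pt)) : ℝ)) := by
    intro b; simpa using hJ₀ b
  have h1 := abs_biContract_le' (J₂ := fun b' => J v (b' - w) - J v b') (k := kt) hδ hn S S' 0 v hMt hJ₁ (hJΔ v) hkt
  have e0 : (supNorm (v - 0) : ℝ) = supNorm v := by simp
  rw [e0] at h1
  have hsplit : ∑ b ∈ S, ∑ b' ∈ S', J₀ b * (k₀ b b' * J v b' + kt b b' * (J v (b' - w) - J v b'))
      = (∑ b ∈ S, ∑ b' ∈ S', J₀ b * k₀ b b' * J v b')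
        + ∑ b ∈ S, ∑ b' ∈ S', J₀ b * kt b b' * (J v (b' - w) - J v b') := by
    rw [← Finset.sum_add_distrib]
    refine Finset.sum_congr rfl fun b _ => ?_
    rw [← Finset.sum_add_distrib]
    refine Finset.sum_congr rfl fun b' _ => ?_
    ring
  rw [hsplit]
  refine (abs_add_le _ _).trans ?_
  have e : (C₁ * (C₂ * M₀ + CΔ * Mt) * ((1 + 480 * Real.exp (δ / 4) * (4 / δ) ^ 4) * (n : ℝ) ^ 4))
        * Real.exp (-(δ / 2) * (supNorm v : ℝ))
      = (C₁ * C₂ * M₀ * ((1 + 480 * Real.exp (δ / 4) * (4 / δ) ^ 4) * (n : ℝ) ^ 4)) * Real.exp (-(δ / 2) * (supNorm v : ℝ))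
        + (C₁ * CΔ * Mt * ((1 + 480 * Real.exp (δ / 4) * (4 / δ) ^ 4) * (n : ℝ) ^ 4)) * Real.exp (-(δ / 2) * (supNorm v : ℝ)) := by
    ring
  rw [e]
  exact add_le_add h0 h1

/-- **(pp), m-INDEXED FAMILIES** (one blocking `N m` per level, e.g. `N m = L^m`): if the letters hold at every level `m ≥ 1` with m-FREE constants in
which the window factor `(N m)⁴` is pre-absorbed — i.e. (P0)∕(P) with `C₁ m`, `C₂ m` and (K) with `M m` such that `C₁ m·C₂ m·M m·(N m)⁴ ≤ B₀` — then the
paired letter holds with the m-free `B = B₀·(1 + 480e^{δ∕4}(4∕δ)⁴)`: the `hpp` binder of `HorizontalBookkeepingPaired.rem_of_pp_uniform`. [folklore] -/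
theorem pp_of_rowMass_uniform {N : ℕ → ℕ} {J₀ : ℕ → Pt → ℝ} {J : ℕ → Pt → Pt → ℝ} {k : ℕ → Pt → Pt → ℝ}
    {C₁ C₂ M : ℕ → ℝ} {B₀ : ℝ} (hδ : 0 < δ) (hN : ∀ m, 1 ≤ m → 1 ≤ N m) (S S' : ℕ → Finset Pt)
    (hM : ∀ m, 1 ≤ m → 0 ≤ M m)
    (hJ₀ : ∀ m, 1 ≤ m → ∀ b, |J₀ m b| ≤ C₁ m * Real.exp (-(δ / N m) * (supNorm b : ℝ)))
    (hJ : ∀ m, 1 ≤ m → ∀ v b', |J m v b'| ≤ C₂ m * Real.exp (-(δ / N m) * (supNorm (b' - (N m : ℤ) • v) : ℝ)))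
    (hk : ∀ m, 1 ≤ m → ∀ b ∈ S m, ∑ b' ∈ S' m, Real.exp ((δ / (2 * N m)) * (supNorm (b' - b) : ℝ)) * |k m b b'| ≤ M m)
    (hB : ∀ m, 1 ≤ m → C₁ m * C₂ m * M m * (N m : ℝ) ^ 4 ≤ B₀) :
    ∀ m, 1 ≤ m → ∀ v : Pt, |∑ b ∈ S m, ∑ b' ∈ S' m, J₀ m b * k m b b' * J m v b'|
      ≤ (B₀ * (1 + 480 * Real.exp (δ / 4) * (4 / δ) ^ 4)) * Real.exp (-(δ / 2) * (supNorm v : ℝ)) := by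
  intro m hm v
  have h := pp_of_rowMass (J := J m) (k := k m) hδ (hN m hm) (S m) (S' m) (hM m hm) (hJ₀ m hm) (hJ m hm) (hk m hm) v
  refine h.trans (mul_le_mul_of_nonneg_right ?_ (Real.exp_pos _).le)
  have hK : 0 ≤ 1 + 480 * Real.exp (δ / 4) * (4 / δ) ^ 4 := by positivity
  calc C₁ m * C₂ m * M m * ((1 + 480 * Real.exp (δ / 4) * (4 / δ) ^ 4) * (N m : ℝ) ^ 4)
      = (C₁ m * C₂ m * M m * (N m : ℝ) ^ 4) * (1 + 480 * Real.exp (δ / 4) * (4 / δ) ^ 4) := by ring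
    _ ≤ B₀ * (1 + 480 * Real.exp (δ / 4) * (4 / δ) ^ 4) := mul_le_mul_of_nonneg_right (hB m hm) hK

end PP

/-- [folklore] **THE ROAD'S UNITS, ONE LINE** (orientation for RHOA-6e ∕ GAMMA-8, not an estimate): with the instance sizes `C₁ = C₂ = c∕n` (columns),
`C_Δ = c′∕n²` (unit difference), `M₀ = m₀∕n²` (plain row mass), `M̃ = m₁∕n` (by-parts row mass), the constant of `pp_of_pair` is n-FREE:
`(c∕n)·((c∕n)·(m₀∕n²) + (c′∕n²)·(m₁∕n))·(K·n⁴) = c·(c·m₀ + c′·m₁)·K`. -/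
theorem road_units_bookkeeping (c c' m₀ m₁ K : ℝ) {n : ℝ} (hn : n ≠ 0) :
    (c / n) * ((c / n) * (m₀ / n ^ 2) + (c' / n ^ 2) * (m₁ / n)) * (K * n ^ 4) = c * (c * m₀ + c' * m₁) * K := by
  field_simp


/-! ## §4 The Abel re-indexing (what turns a supplier's difference structure into the by-parts pairing) -/

/-- [folklore] **ABEL RE-INDEXING ON `ℤ⁴`**: for `g, h : ℤ⁴ → ℝ` and a shift `w`, if `b ↦ g(b+w)·h b` and `b ↦ g b·h b` are summable then
`Σ'_b (g(b+w) − g b)·h b = Σ'_b g b·(h(b−w) − h b)` — a forward difference of the kernel in the running insertion IS the pairing of the kernel with the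
backward difference of the column (no boundary term on the infinite lattice; on a finite window the supplier keeps the boundary layer in `k₀`). -/
theorem tsum_fwdDiff_mul_eq_tsum_mul_bwdDiff (g h : Pt → ℝ) (w : Pt)
    (h1 : Summable fun b => g (b + w) * h b) (h2 : Summable fun b => g b * h b) :
    ∑' b, (g (b + w) - g b) * h b = ∑' b, g b * (h (b - w) - h b) := by
  have h3 : Summable fun b => g b * h (b - w) := by
    have e : (fun b => g b * h (b - w)) ∘ (Equiv.addRight w) = fun b => g (b + w) * h b := by
      funext b; simp
    exact (Equiv.summable_iff (Equiv.addRight w)).mp (e ▸ h1)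
  have hshift : ∑' b, g (b + w) * h b = ∑' b, g b * h (b - w) := by
    rw [← (Equiv.addRight w).tsum_eq (fun b => g b * h (b - w))]
    refine tsum_congr fun b => ?_
    simp
  calc ∑' b, (g (b + w) - g b) * h b = ∑' b, (g (b + w) * h b - g b * h b) := by simp_rw [sub_mul]
    _ = (∑' b, g (b + w) * h b) - ∑' b, g b * h b := h1.tsum_sub h2
    _ = (∑' b, g b * h (b - w)) - ∑' b, g b * h b := by rw [hshift]
    _ = ∑' b, (g b * h (b - w) - g b * h b) := (h3.tsum_sub h2).symm
    _ = ∑' b, g b * (h (b - w) - h b) := by simp_rw [mul_sub]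

end Summit.QuantumFields.BalabanUV.Beta.FP.CoarseContractionProfile

end
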